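import Mathlib.Analysis.SpecialFunctions.Pow.Real
import Mathlib.Analysis.SpecialFunctions.Log.Basic
import Mathlib.Analysis.Complex.ExponentialBounds
import Mathlib.NumberTheory.Harmonic.Bounds
import Mathlib.Algebra.BigOperators.Intervals
import HarnessLib

/-!
# Real-analysis lemmas for stub `orbitFloorLog_of_ratioDegree` (line `orbit-interpolation-determinant`, crux `ApproximationProperty`, stmt-Schanuel-6117)

Crux `stmt-Schanuel-6117` (`Summit.Schanuel.Schanuel.Theses.DiophantineDichotomy.ApproximationProperty`),
route `DiophantineDichotomy`, line `orbit-interpolation-determinant`, stub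
`orbitFloorLog_of_ratioDegree` (the ORBIT FLOOR in log form from the ratio-degree lemma; file
`…OrbitFloorLogOfRatioDegree.lean`, which imports this one). Helper file, PROOFS ONLY (no
definitions, no named facts): the layer cake and the real arithmetic of the floor.

* `OrbitFloorLogLemmas.sum_range_one_div_succ_le` (`Σ_{i<N} 1/(i+1) ≤ 1 + log N`, from Mathlib's
  `harmonic_le_one_add_log`), `sum_range_one_div_sqrt_succ_le` (`Σ_{i<N} 1/√(i+1) ≤ 2√N`),
  `sum_shell_le` (summing a per-shell bound `a + b/ℓ + s/√ℓ`);
* `OrbitFloorLogLemmas.sum_log_inv_le_sum_card` — the LAYER CAKE: if `ρ_σ ≥ e^{−L}` for all `σ`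
  then `Σ_σ log(1/ρ_σ) ≤ Σ_{ℓ=0}^{⌊L⌋} #{σ : ρ_σ ≤ e^{−ℓ}}`;
* `OrbitFloorLogLemmas.le_of_quad_le` (`a k² ≤ b k + d ⇒ k ≤ b/a + √(d/a)`),
  `shell_count_real` (the per-shell count extracted from the lever inequality
  `(c₀k² − k) log(1/r) ≤ C₀(W + kV)` and the fibre size), `shell_uniform` (shells below `ℓ₀`);
* `OrbitFloorLogLemmas.absorb`, `absorb_far` — absorption of the collected bound into
  `C · (δₛ L + h + D log(D+2) + D log(L+2) + √(D (h + D + δₛ log(D+2)) L))`;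
* `orbitFloorLog_lemmas` — the registered sub-goal of this helper file.

Sources: NesterenkoPhilippon2001 (LNM 1752) Ch. 3 §4 (Prop. 4.13, the average form); folklore
real analysis.
-/

noncomputable section

-- `Summit.Schanuel.Schanuel.…` is the mandated summit/sub-problem namespace (single-conjunct summit), hence:
set_option linter.dupNamespace false

namespace Summit.Schanuel.Schanuel.Cruxes.ApproximationProperty.OrbitInterpolationDeterminant

open scoped BigOperators

namespace OrbitFloorLogLemmas

/-! ### Sums over shells -/

/-- Harmonic sum: `Σ_{i<N} 1/(i+1) ≤ 1 + log N`. [folklore] -/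
theorem sum_range_one_div_succ_le (N : ℕ) :
    ∑ i ∈ Finset.range N, (1 : ℝ) / ((i : ℝ) + 1) ≤ 1 + Real.log N := by
  have h := harmonic_le_one_add_log N
  unfold harmonic at h
  push_cast at h
  simpa only [one_div] using h

/-- `Σ_{i<N} 1/√(i+1) ≤ 2 √N` (telescoping `1/√(i+1) ≤ 2(√(i+1) − √i)`). [folklore] -/
theorem sum_range_one_div_sqrt_succ_le (N : ℕ) :
    ∑ i ∈ Finset.range N, (1 : ℝ) / Real.sqrt ((i : ℝ) + 1) ≤ 2 * Real.sqrt N := by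
  induction N with
  | zero => simp
  | succ N ih =>
    rw [Finset.sum_range_succ]
    have hN0 : (0 : ℝ) ≤ N := Nat.cast_nonneg N
    set s : ℝ := Real.sqrt N with hs
    set t : ℝ := Real.sqrt ((N : ℝ) + 1) with ht
    have ht0 : 0 < t := Real.sqrt_pos.mpr (by positivity)
    have hs2 : s ^ 2 = N := Real.sq_sqrt hN0
    have ht2 : t ^ 2 = N + 1 := Real.sq_sqrt (by positivity)
    have hstep : 1 / t ≤ 2 * t - 2 * s := by
      rw [div_le_iff₀ ht0]
      nlinarith [sq_nonneg (t - s)]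
    have e : ((N + 1 : ℕ) : ℝ) = (N : ℝ) + 1 := by push_cast; ring
    rw [e, ← ht]
    linarith

/-- Summation of a per-shell bound `g(i+1) ≤ a + b/(i+1) + s/√(i+1)` over `i < N`. [folklore] -/
theorem sum_shell_le {N : ℕ} {a b s : ℝ} (hb : 0 ≤ b) (hs : 0 ≤ s) (g : ℕ → ℝ)
    (hg : ∀ i, i < N → g (i + 1) ≤ a + b / ((i : ℝ) + 1) + s * (1 / Real.sqrt ((i : ℝ) + 1))) :
    ∑ i ∈ Finset.range N, g (i + 1) ≤ N * a + b * (1 + Real.log N) + s * (2 * Real.sqrt N) := by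
  calc ∑ i ∈ Finset.range N, g (i + 1)
      ≤ ∑ i ∈ Finset.range N, (a + b / ((i : ℝ) + 1) + s * (1 / Real.sqrt ((i : ℝ) + 1))) :=
        Finset.sum_le_sum fun i hi => hg i (Finset.mem_range.mp hi)
    _ = N * a + b * ∑ i ∈ Finset.range N, 1 / ((i : ℝ) + 1) +
          s * ∑ i ∈ Finset.range N, 1 / Real.sqrt ((i : ℝ) + 1) := by
        rw [Finset.sum_add_distrib, Finset.sum_add_distrib, Finset.sum_const, Finset.card_range,
          nsmul_eq_mul, Finset.mul_sum, Finset.mul_sum]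
        congr 1; congr 1
        exact Finset.sum_congr rfl fun i _ => by ring
    _ ≤ N * a + b * (1 + Real.log N) + s * (2 * Real.sqrt N) := by
        have h1 := mul_le_mul_of_nonneg_left (sum_range_one_div_succ_le N) hb
        have h2 := mul_le_mul_of_nonneg_left (sum_range_one_div_sqrt_succ_le N) hs
        linarith

/-! ### The layer cake -/

/-- **Layer cake**: `Σ_σ log(1/ρ_σ) ≤ Σ_{ℓ=0}^{⌊L⌋} #{σ : ρ_σ ≤ e^{−ℓ}}` when all `ρ_σ ≥ e^{−L}`
(a conjugate with `e^{−ℓ−1} < ρ ≤ e^{−ℓ}` lies in the `ℓ + 1 ≥ log(1/ρ)` shells `0, …, ℓ`).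
[folklore] -/
theorem sum_log_inv_le_sum_card {E : Type*} [Fintype E] (ρ : E → ℝ) {L : ℝ}
    (hρ : ∀ σ, Real.exp (-L) ≤ ρ σ) [∀ ℓ : ℕ, DecidablePred fun σ : E => ρ σ ≤ Real.exp (-(ℓ : ℝ))] :
    ∑ σ, Real.log (1 / ρ σ) ≤
      ∑ ℓ ∈ Finset.range (⌊L⌋₊ + 1),
        ((Finset.univ.filter fun σ => ρ σ ≤ Real.exp (-(ℓ : ℝ))).card : ℝ) := by
  have hrhs : ∑ ℓ ∈ Finset.range (⌊L⌋₊ + 1),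
      ((Finset.univ.filter fun σ => ρ σ ≤ Real.exp (-(ℓ : ℝ))).card : ℝ) =
      ∑ σ, ∑ ℓ ∈ Finset.range (⌊L⌋₊ + 1), if ρ σ ≤ Real.exp (-(ℓ : ℝ)) then (1 : ℝ) else 0 := by
    rw [Finset.sum_comm]
    refine Finset.sum_congr rfl fun ℓ _ => ?_
    rw [Finset.card_filter]
    push_cast
    rfl
  rw [hrhs]
  refine Finset.sum_le_sum fun σ _ => ?_
  have hρ0 : 0 < ρ σ := (Real.exp_pos _).trans_le (hρ σ)
  have hnn : ∀ ℓ ∈ Finset.range (⌊L⌋₊ + 1),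
      (0 : ℝ) ≤ if ρ σ ≤ Real.exp (-(ℓ : ℝ)) then (1 : ℝ) else 0 := fun ℓ _ => by
    split_ifs <;> norm_num
  by_cases h1 : 1 < ρ σ
  · calc Real.log (1 / ρ σ) ≤ 0 := Real.log_nonpos (by positivity) (by
          rw [div_le_one hρ0]; exact h1.le)
      _ ≤ _ := Finset.sum_nonneg hnn
  · push Not at h1
    set u : ℝ := Real.log (1 / ρ σ) with hu
    have hu0 : 0 ≤ u := Real.log_nonneg (by rw [le_div_iff₀ hρ0]; linarith)
    have huL : u ≤ L := by
      rw [hu, one_div, Real.log_inv, neg_le]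
      have := Real.log_le_log (Real.exp_pos _) (hρ σ)
      rwa [Real.log_exp] at this
    have hsub : Finset.range (⌊u⌋₊ + 1) ⊆ Finset.range (⌊L⌋₊ + 1) :=
      Finset.range_subset_range.mpr (Nat.succ_le_succ (Nat.floor_mono huL))
    calc u ≤ (⌊u⌋₊ : ℝ) + 1 := (Nat.lt_floor_add_one u).le
      _ = ∑ ℓ ∈ Finset.range (⌊u⌋₊ + 1), (1 : ℝ) := by simp
      _ = ∑ ℓ ∈ Finset.range (⌊u⌋₊ + 1),
            (if ρ σ ≤ Real.exp (-(ℓ : ℝ)) then (1 : ℝ) else 0) := by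
          refine Finset.sum_congr rfl fun ℓ hℓ => ?_
          have hℓu : (ℓ : ℝ) ≤ u := by
            have : ℓ ≤ ⌊u⌋₊ := Nat.lt_succ_iff.mp (Finset.mem_range.mp hℓ)
            exact le_trans (by exact_mod_cast this) (Nat.floor_le hu0)
          have : ρ σ ≤ Real.exp (-(ℓ : ℝ)) := by
            have e : ρ σ = Real.exp (-u) := by
              rw [hu, one_div, Real.log_inv, neg_neg, Real.exp_log hρ0]
            rw [e, Real.exp_le_exp]; linarith
          rw [if_pos this]
      _ ≤ _ := Finset.sum_le_sum_of_subset_of_nonneg hsub fun ℓ hℓ _ => hnn ℓ hℓ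

/-! ### The per-shell count -/

/-- Solving a quadratic inequality: `a k² ≤ b k + d` with `a > 0`, `b, d ≥ 0` forces
`k ≤ b/a + √(d/a)`. [folklore] -/
theorem le_of_quad_le {a b d k : ℝ} (ha : 0 < a) (hb : 0 ≤ b) (hd : 0 ≤ d)
    (h : a * k ^ 2 ≤ b * k + d) : k ≤ b / a + Real.sqrt (d / a) := by
  by_contra hlt
  push Not at hlt
  set s : ℝ := Real.sqrt (d / a) with hs
  have hs0 : 0 ≤ s := Real.sqrt_nonneg _
  have hs2 : a * s ^ 2 = d := by
    rw [hs, Real.sq_sqrt (by positivity)]; field_simp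
  have h1 : b + a * s < a * k := by
    have := mul_lt_mul_of_pos_left hlt ha
    rwa [mul_add, mul_div_cancel₀ _ ha.ne'] at this
  have hks : s ≤ k := le_trans (le_add_of_nonneg_left (div_nonneg hb ha.le)) hlt.le
  have hk0 : 0 < k := lt_of_le_of_lt (by positivity) hlt
  nlinarith [mul_le_mul_of_nonneg_left hks (mul_nonneg ha.le hs0), mul_lt_mul_of_pos_right h1 hk0]

/-- **The per-shell count** (pure real arithmetic): if `N ≤ f k` conjugates of the shell
`log(1/r) ≥ ℓ/2` restrict to `k` distinct embeddings of the subfield (fibre size `f ≤ δₛ`) and the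
lever gives `(c₀k² − k) log(1/r) ≤ C₀ (W + k V)` with `f² W ≤ D (h_K(b) + D)`,
`f V ≤ D (log(2+|x|) + 1)`, then `N ≤ δₛ/c₀ + 2C₀D(L_ω+1)/(c₀ℓ) + √(2C₀D(h+D)/(c₀ℓ))`. [folklore] -/
theorem shell_count_real {c₀ C₀ ℓ lr W V D hb hgt δs Lx Lω : ℝ} {N k f : ℕ} (hc₀ : 0 < c₀)
    (hC₀ : 0 < C₀) (hℓ : 0 < ℓ) (hlr : ℓ / 2 ≤ lr) (hN : N ≤ f * k) (hfδ : (f : ℝ) ≤ δs)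
    (hW : 0 ≤ W) (hV : 0 ≤ V) (hfW : (f : ℝ) ^ 2 * W ≤ D * (hb + D))
    (hfV : (f : ℝ) * V ≤ D * (Lx + 1)) (hD : 0 ≤ D) (hhb : hb ≤ hgt) (hLx : Lx ≤ Lω)
    (hlev : (c₀ * (k : ℝ) ^ 2 - k) * lr ≤ C₀ * (W + k * V)) :
    (N : ℝ) ≤ δs / c₀ + 2 * C₀ * D * (Lω + 1) / c₀ / ℓ +
      Real.sqrt (2 * C₀ * D * (hgt + D) / c₀ / ℓ) := by
  have hk0 : (0 : ℝ) ≤ k := Nat.cast_nonneg k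
  have hf0 : (0 : ℝ) ≤ f := Nat.cast_nonneg f
  have hNfk : (N : ℝ) ≤ f * k := by exact_mod_cast hN
  -- the bound on `k`
  have hkq : (k : ℝ) ≤ 1 / c₀ + 2 * C₀ * V / (c₀ * ℓ) + Real.sqrt (2 * C₀ * W / (c₀ * ℓ)) := by
    have ht2 : 0 ≤ 2 * C₀ * V / (c₀ * ℓ) := by positivity
    have ht3 : 0 ≤ Real.sqrt (2 * C₀ * W / (c₀ * ℓ)) := Real.sqrt_nonneg _
    by_cases hcase : c₀ * (k : ℝ) ^ 2 - k ≤ 0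
    · have hk1 : (k : ℝ) ≤ 1 / c₀ := by
        rcases eq_or_lt_of_le hk0 with hk00 | hkpos
        · rw [← hk00]; positivity
        · rw [le_div_iff₀ hc₀]; nlinarith
      linarith
    · push Not at hcase
      have h1 : (c₀ * (k : ℝ) ^ 2 - k) * (ℓ / 2) ≤ C₀ * (W + k * V) :=
        (mul_le_mul_of_nonneg_left hlr hcase.le).trans hlev
      have h2 : c₀ * ℓ / 2 * (k : ℝ) ^ 2 ≤ (ℓ / 2 + C₀ * V) * k + C₀ * W := by nlinarith
      have h3 := le_of_quad_le (by positivity) (by positivity) (by positivity) h2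
      have e1 : (ℓ / 2 + C₀ * V) / (c₀ * ℓ / 2) = 1 / c₀ + 2 * C₀ * V / (c₀ * ℓ) := by
        field_simp
      have e2 : C₀ * W / (c₀ * ℓ / 2) = 2 * C₀ * W / (c₀ * ℓ) := by
        field_simp
      rwa [e1, e2] at h3
  -- multiply by the fibre size `f`
  have hA : (f : ℝ) * (1 / c₀) ≤ δs / c₀ := by
    rw [mul_one_div]; exact div_le_div_of_nonneg_right hfδ hc₀.le
  have hB : (f : ℝ) * (2 * C₀ * V / (c₀ * ℓ)) ≤ 2 * C₀ * D * (Lω + 1) / c₀ / ℓ := by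
    rw [div_div, show (f : ℝ) * (2 * C₀ * V / (c₀ * ℓ)) = 2 * C₀ * (f * V) / (c₀ * ℓ) by ring]
    refine div_le_div_of_nonneg_right ?_ (by positivity)
    have : D * (Lx + 1) ≤ D * (Lω + 1) := mul_le_mul_of_nonneg_left (by linarith) hD
    nlinarith
  have hC : (f : ℝ) * Real.sqrt (2 * C₀ * W / (c₀ * ℓ)) ≤
      Real.sqrt (2 * C₀ * D * (hgt + D) / c₀ / ℓ) := by
    rw [← Real.sqrt_sq hf0, ← Real.sqrt_mul (sq_nonneg _)]
    refine Real.sqrt_le_sqrt ?_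
    rw [div_div, show (f : ℝ) ^ 2 * (2 * C₀ * W / (c₀ * ℓ)) = 2 * C₀ * (f ^ 2 * W) / (c₀ * ℓ) by ring]
    refine div_le_div_of_nonneg_right ?_ (by positivity)
    have : D * (hb + D) ≤ D * (hgt + D) := mul_le_mul_of_nonneg_left (by linarith) hD
    nlinarith
  calc (N : ℝ) ≤ f * k := hNfk
    _ ≤ f * (1 / c₀ + 2 * C₀ * V / (c₀ * ℓ) + Real.sqrt (2 * C₀ * W / (c₀ * ℓ))) :=
        mul_le_mul_of_nonneg_left hkq hf0
    _ = f * (1 / c₀) + f * (2 * C₀ * V / (c₀ * ℓ)) + f * Real.sqrt (2 * C₀ * W / (c₀ * ℓ)) := by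
        ring
    _ ≤ _ := by linarith

/-- Uniform per-shell bound: the shells below `ℓ₀` cost `ℓ₀ D / ℓ`. [folklore] -/
theorem shell_uniform {Ncard D a B X ℓ ℓ₀ : ℝ} (hℓ : 0 < ℓ) (hD : 0 ≤ D) (ha : 0 ≤ a) (hB : 0 ≤ B)
    (hX : 0 ≤ X) (hℓ₀ : 0 ≤ ℓ₀) (hND : Ncard ≤ D)
    (h : ℓ₀ ≤ ℓ → Ncard ≤ a + B / ℓ + Real.sqrt (X / ℓ)) :
    Ncard ≤ a + (B + ℓ₀ * D) / ℓ + Real.sqrt X * (1 / Real.sqrt ℓ) := by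
  have hs : Real.sqrt (X / ℓ) = Real.sqrt X * (1 / Real.sqrt ℓ) := by
    rw [Real.sqrt_div hX, mul_one_div]
  have hs0 : 0 ≤ Real.sqrt X * (1 / Real.sqrt ℓ) := by positivity
  rw [add_div]
  by_cases hl : ℓ₀ ≤ ℓ
  · have := h hl
    rw [hs] at this
    have : 0 ≤ ℓ₀ * D / ℓ := by positivity
    linarith
  · push Not at hl
    have h1 : Ncard ≤ ℓ₀ * D / ℓ := by
      rw [le_div_iff₀ hℓ]
      nlinarith [mul_le_mul_of_nonneg_right hl.le hD, hND]
    have h2 : 0 ≤ B / ℓ := by positivity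
    linarith

/-! ### Absorption into the five terms of the floor -/

/-- `1 ≤ log (x + 2)` for `x ≥ 1` (`e < 3`). [folklore] -/
theorem one_le_log_add_two {x : ℝ} (hx : 1 ≤ x) : 1 ≤ Real.log (x + 2) := by
  have h3 : (1 : ℝ) ≤ Real.log 3 := by
    rw [Real.le_log_iff_exp_le (by norm_num)]
    exact Real.exp_one_lt_three.le
  exact h3.trans (Real.log_le_log (by norm_num) (by linarith))

/-- **Absorption** of the collected bound `c D + D + ⌊L⌋ δₛ/c₀ + (2C₀D(L_ω+1)/c₀ + ℓ₀D)(1 + log ⌊L⌋)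
+ 2 √(2C₀D(h + cD + D)/c₀) √⌊L⌋` into `C · (δₛ L + h + D log(D+2) + D log(L+2) + √(D(h+D+δₛ log(D+2))L))`
with `C = c + 1 + Θ_l + 1/c₀ + 2(2C₀(L_ω+1)/c₀ + ℓ₀) + 2√(2C₀(c+1)/c₀)`. [folklore] -/
theorem absorb {S c c₀ C₀ Lω Θl D h δs L Nf ℓ₀ : ℝ} (hc : 0 < c) (hc₀ : 0 < c₀) (hC₀ : 0 < C₀)
    (hLω : 0 ≤ Lω) (hΘl : 0 ≤ Θl) (hℓ₀ : 0 ≤ ℓ₀) (hD : 1 ≤ D) (hh : 0 ≤ h) (hδs : 0 ≤ δs)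
    (hL : 1 ≤ L) (hNf1 : 1 ≤ Nf) (hNfL : Nf ≤ L)
    (hS : S ≤ c * D + (D + (Nf * (δs / c₀) +
      (2 * C₀ * D * (Lω + 1) / c₀ + ℓ₀ * D) * (1 + Real.log Nf) +
      Real.sqrt (2 * C₀ * D * (h + c * D + D) / c₀) * (2 * Real.sqrt Nf)))) :
    S ≤ (c + 1 + Θl + 1 / c₀ + 2 * (2 * C₀ * (Lω + 1) / c₀ + ℓ₀) +
        2 * Real.sqrt (2 * C₀ * (c + 1) / c₀)) *
      (δs * L + h + D * Real.log (D + 2) + D * Real.log (L + 2) +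
        Real.sqrt (D * (h + D + δs * Real.log (D + 2)) * L)) := by
  -- the target terms and their coefficients
  set t1 : ℝ := δs * L with ht1
  set t3 : ℝ := D * Real.log (D + 2) with ht3
  set t4 : ℝ := D * Real.log (L + 2) with ht4
  set P : ℝ := δs * Real.log (D + 2) with hP
  set t5 : ℝ := Real.sqrt (D * (h + D + P) * L) with ht5
  set k1 : ℝ := 1 / c₀ with hk1
  set k4 : ℝ := 2 * (2 * C₀ * (Lω + 1) / c₀ + ℓ₀) with hk4
  set k5 : ℝ := 2 * Real.sqrt (2 * C₀ * (c + 1) / c₀) with hk5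
  have hD0 : 0 ≤ D := by linarith
  have hL0 : 0 ≤ L := by linarith
  have hlogD : 1 ≤ Real.log (D + 2) := one_le_log_add_two hD
  have hlogL : 1 ≤ Real.log (L + 2) := one_le_log_add_two hL
  have hlogD0 : 0 ≤ Real.log (D + 2) := by linarith
  have hP0 : 0 ≤ P := by positivity
  have ht10 : 0 ≤ t1 := by positivity
  have ht30 : 0 ≤ t3 := by positivity
  have ht40 : 0 ≤ t4 := by positivity
  have ht50 : 0 ≤ t5 := Real.sqrt_nonneg _
  have hk10 : 0 ≤ k1 := by positivity
  have hk40 : 0 ≤ k4 := by positivity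
  have hk50 : 0 ≤ k5 := by positivity
  -- piece 1: `c D + D ≤ (c+1) t3`
  have p1 : c * D + D ≤ (c + 1) * t3 := by
    have h1 : D ≤ t3 := le_mul_of_one_le_right hD0 hlogD
    nlinarith [mul_le_mul_of_nonneg_left h1 hc.le]
  -- piece 2: `⌊L⌋ δₛ/c₀ ≤ (1/c₀) t1`
  have p2 : Nf * (δs / c₀) ≤ k1 * t1 := by
    have h1 : Nf * δs ≤ δs * L := by nlinarith
    calc Nf * (δs / c₀) = Nf * δs / c₀ := by ring
      _ ≤ δs * L / c₀ := div_le_div_of_nonneg_right h1 hc₀.le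
      _ = k1 * t1 := by rw [hk1, ht1]; ring
  -- piece 3: the `log` term, `1 + log ⌊L⌋ ≤ 2 log(L+2)`
  have p3 : (2 * C₀ * D * (Lω + 1) / c₀ + ℓ₀ * D) * (1 + Real.log Nf) ≤ k4 * t4 := by
    have hlogNf : Real.log Nf ≤ Real.log (L + 2) :=
      Real.log_le_log (by linarith) (by linarith)
    have e : 2 * C₀ * D * (Lω + 1) / c₀ + ℓ₀ * D = (2 * C₀ * (Lω + 1) / c₀ + ℓ₀) * D := by ring
    rw [e]
    calc (2 * C₀ * (Lω + 1) / c₀ + ℓ₀) * D * (1 + Real.log Nf)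
        ≤ (2 * C₀ * (Lω + 1) / c₀ + ℓ₀) * D * (2 * Real.log (L + 2)) :=
          mul_le_mul_of_nonneg_left (by linarith) (by positivity)
      _ = k4 * t4 := by rw [hk4, ht4]; ring
  -- piece 4: the square root
  have p4 : Real.sqrt (2 * C₀ * D * (h + c * D + D) / c₀) * (2 * Real.sqrt Nf) ≤ k5 * t5 := by
    have hin : 2 * C₀ * D * (h + c * D + D) / c₀ * Nf ≤
        2 * C₀ * (c + 1) / c₀ * (D * (h + D + P) * L) := by
      have a1 : (h + c * D + D) * Nf ≤ (h + c * D + D) * L :=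
        mul_le_mul_of_nonneg_left hNfL (by positivity)
      have a2 : (h + c * D + D) ≤ (c + 1) * (h + D + P) := by
        have e2 : (c + 1) * (h + D + P) - (h + c * D + D) = c * h + (c + 1) * P := by ring
        have : 0 ≤ c * h + (c + 1) * P := by positivity
        linarith
      have a4 : (h + c * D + D) * Nf ≤ (c + 1) * (h + D + P) * L :=
        a1.trans (mul_le_mul_of_nonneg_right a2 hL0)
      have a5 := mul_le_mul_of_nonneg_left a4 (show 0 ≤ 2 * C₀ / c₀ * D by positivity)
      have e3 : 2 * C₀ * D * (h + c * D + D) / c₀ * Nf =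
          2 * C₀ / c₀ * D * ((h + c * D + D) * Nf) := by ring
      have e4 : 2 * C₀ * (c + 1) / c₀ * (D * (h + D + P) * L) =
          2 * C₀ / c₀ * D * ((c + 1) * (h + D + P) * L) := by ring
      rw [e3, e4]; exact a5
    calc Real.sqrt (2 * C₀ * D * (h + c * D + D) / c₀) * (2 * Real.sqrt Nf)
        = 2 * Real.sqrt (2 * C₀ * D * (h + c * D + D) / c₀ * Nf) := by
          rw [Real.sqrt_mul (by positivity)]; ring
      _ ≤ 2 * Real.sqrt (2 * C₀ * (c + 1) / c₀ * (D * (h + D + P) * L)) := by gcongr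
      _ = k5 * t5 := by rw [hk5, ht5, Real.sqrt_mul (by positivity)]; ring
  -- collect: every coefficient is at most `C`, every target term is non-negative
  set Cb : ℝ := c + 1 + Θl + k1 + k4 + k5 with hCb
  have q1 : k1 * t1 ≤ Cb * t1 := mul_le_mul_of_nonneg_right (by rw [hCb]; linarith) ht10
  have q3 : (c + 1) * t3 ≤ Cb * t3 := mul_le_mul_of_nonneg_right (by rw [hCb]; linarith) ht30
  have q4 : k4 * t4 ≤ Cb * t4 := mul_le_mul_of_nonneg_right (by rw [hCb]; linarith) ht40
  have q5 : k5 * t5 ≤ Cb * t5 := mul_le_mul_of_nonneg_right (by rw [hCb]; linarith) ht50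
  have q2 : 0 ≤ Cb * h := mul_nonneg (by positivity) hh
  have efin : Cb * (t1 + h + t3 + t4 + t5) = Cb * t1 + Cb * h + Cb * t3 + Cb * t4 + Cb * t5 := by
    ring
  rw [efin]
  linarith

/-- Absorption in the degenerate chart (`b₀ = 0`: every conjugate is far, `S ≤ cD + D Θ_l`).
[folklore] -/
theorem absorb_far {S c c₀ C₀ Lω Θl D h δs L ℓ₀ : ℝ} (hc : 0 < c) (hc₀ : 0 < c₀) (hC₀ : 0 < C₀)
    (hLω : 0 ≤ Lω) (hΘl : 0 ≤ Θl) (hℓ₀ : 0 ≤ ℓ₀) (hD : 1 ≤ D) (hh : 0 ≤ h) (hδs : 0 ≤ δs)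
    (hL : 1 ≤ L) (hS : S ≤ c * D + D * Θl) :
    S ≤ (c + 1 + Θl + 1 / c₀ + 2 * (2 * C₀ * (Lω + 1) / c₀ + ℓ₀) +
        2 * Real.sqrt (2 * C₀ * (c + 1) / c₀)) *
      (δs * L + h + D * Real.log (D + 2) + D * Real.log (L + 2) +
        Real.sqrt (D * (h + D + δs * Real.log (D + 2)) * L)) := by
  have hD0 : 0 ≤ D := by linarith
  have hL0 : 0 ≤ L := by linarith
  have hlogD : 1 ≤ Real.log (D + 2) := one_le_log_add_two hD
  have hlogL : 1 ≤ Real.log (L + 2) := one_le_log_add_two hL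
  have hlogD0 : 0 ≤ Real.log (D + 2) := by linarith
  set t3 : ℝ := D * Real.log (D + 2) with ht3
  have h1 : c * D + D * Θl ≤ (c + 1 + Θl) * t3 := by
    have a1 : D ≤ t3 := le_mul_of_one_le_right hD0 hlogD
    have a2 : c * D ≤ c * t3 := mul_le_mul_of_nonneg_left a1 hc.le
    have a3 : D * Θl ≤ t3 * Θl := mul_le_mul_of_nonneg_right a1 hΘl
    nlinarith
  set rest : ℝ := 1 / c₀ + 2 * (2 * C₀ * (Lω + 1) / c₀ + ℓ₀) +
      2 * Real.sqrt (2 * C₀ * (c + 1) / c₀) with hrest_def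
  have hrest : 0 ≤ rest := by positivity
  set t : ℝ := δs * L + h + D * Real.log (L + 2) +
      Real.sqrt (D * (h + D + δs * Real.log (D + 2)) * L) with ht_def
  have ht : 0 ≤ t := by positivity
  have ht30 : 0 ≤ t3 := by positivity
  have hcΘ : 0 ≤ c + 1 + Θl := by positivity
  have e : (c + 1 + Θl + 1 / c₀ + 2 * (2 * C₀ * (Lω + 1) / c₀ + ℓ₀) +
        2 * Real.sqrt (2 * C₀ * (c + 1) / c₀)) *
      (δs * L + h + D * Real.log (D + 2) + D * Real.log (L + 2) +
        Real.sqrt (D * (h + D + δs * Real.log (D + 2)) * L)) =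
      (c + 1 + Θl) * t3 + ((c + 1 + Θl) * t + rest * (t + t3)) := by
    rw [hrest_def, ht_def, ht3]; ring
  rw [e]
  have : 0 ≤ (c + 1 + Θl) * t + rest * (t + t3) := by positivity
  linarith

end OrbitFloorLogLemmas

/-! ### The registered sub-goal of this helper file -/

open OrbitFloorLogLemmas in
/-- **Registered sub-goal `orbitFloorLog_lemmas`** (crux `stmt-Schanuel-6117`, line
`orbit-interpolation-determinant`; the part of stub `orbitFloorLog_of_ratioDegree` carried by this
helper file): the two shell sums `Σ_{i<N} 1/(i+1) ≤ 1 + log N`, `Σ_{i<N} 1/√(i+1) ≤ 2√N`, and the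
quadratic extraction `a k² ≤ b k + d ⇒ k ≤ b/a + √(d/a)`. [folklore] -/
theorem orbitFloorLog_lemmas : (∀ N : ℕ, ∑ i ∈ Finset.range N, (1 : ℝ) / ((i : ℝ) + 1) ≤ 1 + Real.log N) ∧ (∀ N : ℕ, ∑ i ∈ Finset.range N, (1 : ℝ) / Real.sqrt ((i : ℝ) + 1) ≤ 2 * Real.sqrt N) ∧ (∀ a b d k : ℝ, 0 < a → 0 ≤ b → 0 ≤ d → a * k ^ 2 ≤ b * k + d → k ≤ b / a + Real.sqrt (d / a)) :=
  ⟨sum_range_one_div_succ_le, sum_range_one_div_sqrt_succ_le,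
    fun _ _ _ _ ha hb hd h => le_of_quad_le ha hb hd h⟩

end Summit.Schanuel.Schanuel.Cruxes.ApproximationProperty.OrbitInterpolationDeterminant

end
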